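import Mathlib
import Summits.Ventures.DiscreteObjects.Mahler.SmythTheorem
import Summits.Ventures.DiscreteObjects.Mahler.SubLehmerDegree56

/-!
# Smyth's theorem, Corollary 12.3: counting nonreciprocal factors (venture `DiscreteObjects`, target L)

Cell `pub-namedobj`, seat `pub-namedobj-mahler` (gen 9). Framing: lottery ticket; floor = certified
bounds/negative ranges.

[McKee–Smyth, *Around the Unit Circle*, Cor. 12.3 p.205]: "An integer polynomial `P(z)` has at most
`log M(P(z)) / log M(z³ - z - 1)` irreducible nonreciprocal factors, counted with multiplicity."  Since the
kernel's Smyth inequality `intMahlerMeasure_ge_smythTheta_of_nonreciprocal` needs no irreducibility, we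
prove the corollary for an arbitrary factorisation into nonzero integer polynomials: if `P = ∏_{f ∈ F} f`
and `G ≤ F` is a sub-multiset of factors which are nonreciprocal with `f(0) ≠ 0`, then
`θ₀^{|G|} ≤ M(P)`, i.e. `|G| ≤ log M(P) / log θ₀`.

* `smythTheta_pow_card_le_intMahlerMeasure_prod` — `θ₀^{|G|} ≤ M(∏ G)` for nonreciprocal factors;
* `smythTheta_pow_card_le_intMahlerMeasure` — `θ₀^{|G|} ≤ M(∏ F)` for `G ≤ F`, all factors nonzero;
* `card_nonreciprocal_factors_le` — **Cor. 12.3**: `|G| ≤ log M(∏ F) / log θ₀`.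
-/

namespace Summit.Ventures.DiscreteObjects.Mahler

open Polynomial

/-- `θ₀^{|G|} ≤ M(∏ G)` when every `f ∈ G` is nonreciprocal with `f(0) ≠ 0` (Smyth for each factor). -/
theorem smythTheta_pow_card_le_intMahlerMeasure_prod (G : Multiset ℤ[X])
    (hG : ∀ f ∈ G, f.coeff 0 ≠ 0 ∧ f.reverse ≠ f ∧ f.reverse ≠ -f) :
    smythTheta ^ Multiset.card G ≤ intMahlerMeasure G.prod := by
  induction G using Multiset.induction_on with
  | empty =>
    simp only [Multiset.card_zero, pow_zero, Multiset.prod_zero]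
    unfold intMahlerMeasure
    rw [Polynomial.map_one, mahlerMeasure_one]
  | cons f G ih =>
    rw [Multiset.card_cons, pow_succ, Multiset.prod_cons, intMahlerMeasure_mul, mul_comm]
    obtain ⟨h0, h1, h2⟩ := hG f (Multiset.mem_cons_self f G)
    have hf := intMahlerMeasure_ge_smythTheta_of_nonreciprocal h0 h1 h2
    have hG' := ih (fun g hg => hG g (Multiset.mem_cons_of_mem hg))
    have hθ := smythTheta_pos
    exact mul_le_mul hf hG' (pow_nonneg hθ.le _) (le_trans hθ.le hf)

/-- `θ₀^{|G|} ≤ M(∏ F)` for a sub-multiset `G ≤ F` of nonreciprocal factors with nonzero constant term,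
all factors in `F` being nonzero. -/
theorem smythTheta_pow_card_le_intMahlerMeasure {F G : Multiset ℤ[X]} (hF : ∀ f ∈ F, f ≠ 0) (hGF : G ≤ F)
    (hG : ∀ f ∈ G, f.coeff 0 ≠ 0 ∧ f.reverse ≠ f ∧ f.reverse ≠ -f) :
    smythTheta ^ Multiset.card G ≤ intMahlerMeasure F.prod := by
  obtain ⟨H, rfl⟩ := Multiset.le_iff_exists_add.mp hGF
  rw [Multiset.prod_add, intMahlerMeasure_mul]
  have h1 := smythTheta_pow_card_le_intMahlerMeasure_prod G hG
  have hH0 : H.prod ≠ 0 :=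
    Multiset.prod_ne_zero (fun h => hF 0 (Multiset.mem_add.mpr (Or.inr h)) rfl)
  have h2 : 1 ≤ intMahlerMeasure H.prod := one_le_intMahlerMeasure hH0
  have h0 : 0 ≤ smythTheta ^ Multiset.card G := pow_nonneg smythTheta_pos.le _
  nlinarith

/-- **[McKee–Smyth, Cor. 12.3]** (without irreducibility): if `F` is a multiset of nonzero integer
polynomials and `G ≤ F` consists of nonreciprocal ones with nonzero constant term, then
`|G| ≤ log M(∏ F) / log θ₀` — an integer polynomial has at most `log M(P)/log M(z³ - z - 1)` nonreciprocal
factors with nonzero constant term, counted with multiplicity, in any factorisation. -/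
theorem card_nonreciprocal_factors_le {F G : Multiset ℤ[X]} (hF : ∀ f ∈ F, f ≠ 0) (hGF : G ≤ F)
    (hG : ∀ f ∈ G, f.coeff 0 ≠ 0 ∧ f.reverse ≠ f ∧ f.reverse ≠ -f) :
    (Multiset.card G : ℝ) ≤ Real.log (intMahlerMeasure F.prod) / Real.log smythTheta := by
  have h := smythTheta_pow_card_le_intMahlerMeasure hF hGF hG
  have hθ1 : 1 < smythTheta := lt_trans (by norm_num) smythTheta_gt
  have hlogθ : 0 < Real.log smythTheta := Real.log_pos hθ1
  have hpow : 0 < smythTheta ^ Multiset.card G := pow_pos smythTheta_pos _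
  rw [le_div_iff₀ hlogθ, ← Real.log_pow]
  exact Real.log_le_log hpow h

end Summit.Ventures.DiscreteObjects.Mahler
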